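import Summits.QuantumFields.QCD.Theorems.SmallFieldUltracontractivity.Negative.Tightness
import Literature.Probability.LatticeModels.TorusFourierProofs
import Mathlib.Analysis.Normed.Algebra.MatrixExponential
import Mathlib.Analysis.SpecialFunctions.Exponential
import Mathlib.Analysis.Calculus.Deriv.Mul
import Mathlib.Analysis.Calculus.Deriv.Shift
import Mathlib.MeasureTheory.Integral.IntervalIntegral.FundThmCalculus
import Mathlib.Topology.Algebra.Module.FiniteDimension
import Mathlib.Tactic.NoncommRing

/-!
# Stub `stub_rowDuhamel` of line `point-centred-axial-parabolic`
(crux `Summit.QuantumFields.QCD.Theses.HeatSlicedQuarks.SmallFieldUltracontractivity`, item stmt-QuantumFields-8871)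

**The cut-off Duhamel formula, entrywise.** For square complex matrices `H₁, H, M`, a weight
`θ : ℝ → ℝ` differentiable on `[s₀, s₁]` (`s₀ ≤ s₁`) with derivative `θ'` continuous there, put
`Φ(τ) = θ(τ) · e^{-(s₁-τ)H₁} M e^{-τH}`. Since `d/dτ e^{-(s₁-τ)H₁} = e^{-(s₁-τ)H₁} H₁` and
`d/dτ e^{-τH} = -H e^{-τH}` (one-parameter groups, `hasDerivAt_exp_smul_const(')`), the product
rule gives `Φ'(τ) = e^{-(s₁-τ)H₁} (θ(τ)(H₁M - MH) + θ'(τ)M) e^{-τH}`, and the fundamental theorem of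
calculus gives `Φ(s₁) - Φ(s₀) = ∫_{s₀}^{s₁} Φ'(τ) dτ`; the registered statement is the `(i, j)`
entry of this identity (entry evaluation is a continuous linear map, so it commutes with the
derivative, and the interval integral is taken in `ℂ`).

Lean route: matrices carry the `L^∞` operator norm *locally* (`open scoped Matrix.Norms.Operator`,
exactly as in `Mathlib/Analysis/Normed/Algebra/MatrixExponential.lean`); the derivative is computed
with real scalars (`𝕂 = ℝ`) and translated to the statement's complex coercions by
`((r : ℝ) : ℂ) • X = r • X`; then `intervalIntegral.integral_eq_sub_of_hasDerivAt` for the scalar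
function `τ ↦ Φ(τ) i j`, whose derivative is continuous on `[s₀, s₁]`. Everything is Mathlib; no
named fact is used. [folklore]
-/

noncomputable section

namespace Summit.QuantumFields.QCD.Cruxes.SmallFieldUltracontractivity.PointCentredAxialParabolic

open Literature.MathematicalPhysics.QuantumLattice Literature.MathematicalPhysics.QuantumFieldTheory
open Literature.Probability.LatticeModels (TorusSite torusChar)
open Summit.QuantumFields.QCD.Theorems.SmallFieldUltracontractivity.Negative
open scoped Matrix ComplexConjugate

section RowDuhamelHelpers

/-! ### Calculus of `τ ↦ θ(τ) e^{(τ-s₁)H₁} M e^{-τH}` in the `L^∞` operator norm -/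

open NormedSpace
open scoped Matrix.Norms.Operator

variable {κ : Type*} [Fintype κ] [DecidableEq κ]

omit [Fintype κ] [DecidableEq κ] in
/-- Real scalars act on complex matrices through the coercion `ℝ → ℂ`:
`((r : ℝ) : ℂ) • X = r • X`. -/
theorem rowDuhamel_coe_smul (r : ℝ) (X : Matrix κ κ ℂ) : ((r : ℂ) • X) = r • X := by
  ext i j
  simp [Matrix.smul_apply, Complex.real_smul]

omit [DecidableEq κ] in
set_option backward.isDefEq.respectTransparency false in
/-- Entry evaluation `X ↦ X i j` commutes with derivatives of matrix-valued curves (it is a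
continuous linear map on the finite-dimensional space of matrices). -/
theorem rowDuhamel_hasDerivAt_apply {F : ℝ → Matrix κ κ ℂ} {F' : Matrix κ κ ℂ} {t : ℝ}
    (h : HasDerivAt F F' t) (i j : κ) : HasDerivAt (fun τ => F τ i j) (F' i j) t := by
  have hc := (LinearMap.toContinuousLinearMap
    (Matrix.entryLinearMap ℝ ℂ i j)).hasFDerivAt.comp_hasDerivAt t h
  simpa [Function.comp_def] using hc

omit [DecidableEq κ] in
set_option backward.isDefEq.respectTransparency false in
/-- Entry evaluation `X ↦ X i j` preserves continuity of matrix-valued maps on a set. -/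
theorem rowDuhamel_continuousOn_apply {F : ℝ → Matrix κ κ ℂ} {S : Set ℝ}
    (h : ContinuousOn F S) (i j : κ) : ContinuousOn (fun τ => F τ i j) S := by
  have hc := (LinearMap.toContinuousLinearMap
    (Matrix.entryLinearMap ℝ ℂ i j)).continuous.comp_continuousOn h
  simpa [Function.comp_def] using hc

set_option backward.isDefEq.respectTransparency false in
/-- **Derivative of the two-sided heat conjugation.** For square complex matrices `H₁, H, M` and
real `s₁`, the curve `τ ↦ e^{(τ-s₁)H₁} M e^{τ(-H)}` has derivative
`e^{(t-s₁)H₁} (H₁ M - M H) e^{t(-H)}` at every real `t`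
(`d/dτ e^{(τ-s₁)H₁} = e^{(τ-s₁)H₁} H₁`, `d/dτ e^{τ(-H)} = -H e^{τ(-H)}`, product rule). -/
theorem rowDuhamel_hasDerivAt_conj (H₁ H M : Matrix κ κ ℂ) (s₁ t : ℝ) :
    HasDerivAt (fun τ : ℝ => exp ((τ - s₁) • H₁) * M * exp (τ • (-H)))
      (exp ((t - s₁) • H₁) * (H₁ * M - M * H) * exp (t • (-H))) t := by
  have h1 : HasDerivAt (fun τ : ℝ => exp ((τ - s₁) • H₁)) (exp ((t - s₁) • H₁) * H₁) t :=
    HasDerivAt.comp_sub_const t s₁ (hasDerivAt_exp_smul_const (𝕂 := ℝ) H₁ (t - s₁))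
  have h2 : HasDerivAt (fun τ : ℝ => exp (τ • (-H))) (-H * exp (t • (-H))) t :=
    hasDerivAt_exp_smul_const' (𝕂 := ℝ) (-H) t
  have h := (h1.mul_const M).mul h2
  have he : exp ((t - s₁) • H₁) * H₁ * M * exp (t • (-H)) +
      exp ((t - s₁) • H₁) * M * (-H * exp (t • (-H))) =
      exp ((t - s₁) • H₁) * (H₁ * M - M * H) * exp (t • (-H)) := by
    noncomm_ring
  rw [he] at h
  exact h

set_option backward.isDefEq.respectTransparency false in
/-- **Derivative of the weighted two-sided heat conjugation.** If the real weight `θ` has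
derivative `θ't` at `t`, then `τ ↦ θ(τ) · e^{(τ-s₁)H₁} M e^{τ(-H)}` has derivative
`e^{(t-s₁)H₁} (θ(t)(H₁ M - M H) + θ't M) e^{t(-H)}` at `t` (Leibniz rule for the scalar weight,
then `rowDuhamel_hasDerivAt_conj`). -/
theorem rowDuhamel_hasDerivAt_weighted (H₁ H M : Matrix κ κ ℂ) {θ : ℝ → ℝ} {θ't : ℝ} (s₁ : ℝ)
    {t : ℝ} (hθ : HasDerivAt θ θ't t) :
    HasDerivAt (fun τ : ℝ => θ τ • (exp ((τ - s₁) • H₁) * M * exp (τ • (-H))))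
      (exp ((t - s₁) • H₁) * (θ t • (H₁ * M - M * H) + θ't • M) * exp (t • (-H))) t := by
  have h := hθ.fun_smul (rowDuhamel_hasDerivAt_conj H₁ H M s₁ t)
  have he : θ t • (exp ((t - s₁) • H₁) * (H₁ * M - M * H) * exp (t • (-H))) +
      θ't • (exp ((t - s₁) • H₁) * M * exp (t • (-H))) =
      exp ((t - s₁) • H₁) * (θ t • (H₁ * M - M * H) + θ't • M) * exp (t • (-H)) := by
    simp only [mul_add, add_mul, mul_smul_comm, smul_mul_assoc]
  rw [he] at h
  exact h

set_option backward.isDefEq.respectTransparency false in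
/-- Continuity of the Duhamel integrand `τ ↦ e^{(τ-s₁)H₁} (θ(τ)(H₁M - MH) + θ'(τ)M) e^{τ(-H)}` on a
set where the real functions `θ, θ'` are continuous. -/
theorem rowDuhamel_continuousOn_integrand (H₁ H M : Matrix κ κ ℂ) {θ θ' : ℝ → ℝ} (s₁ : ℝ)
    {S : Set ℝ} (hθ : ContinuousOn θ S) (hθ' : ContinuousOn θ' S) :
    ContinuousOn (fun τ : ℝ =>
      exp ((τ - s₁) • H₁) * (θ τ • (H₁ * M - M * H) + θ' τ • M) * exp (τ • (-H))) S := by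
  have h1 : Continuous fun τ : ℝ => exp ((τ - s₁) • H₁) := by fun_prop
  have h2 : Continuous fun τ : ℝ => exp (τ • (-H)) := by fun_prop
  exact (h1.continuousOn.mul ((hθ.smul continuousOn_const).add (hθ'.smul continuousOn_const))).mul
    h2.continuousOn

end RowDuhamelHelpers

set_option backward.isDefEq.respectTransparency false in
/-- **Derivative of the weighted heat conjugation, entrywise, in the statement's vocabulary.** If
`θ` has derivative `θ't` at `t`, then for all indices `i, j` the scalar function
`τ ↦ (θ(τ) · e^{-(s₁-τ)H₁} M e^{-τH}) i j` has derivative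
`(e^{-(s₁-t)H₁} (θ(t)(H₁M - MH) + θ't M) e^{-tH}) i j` at `t` (all scalars written as the complex
coercions `((· : ℝ) : ℂ)` of the registered statement). -/
theorem rowDuhamel_hasDerivAt_entry {κ : Type*} [Fintype κ] [DecidableEq κ]
    (H₁ H M : Matrix κ κ ℂ) {θ : ℝ → ℝ} {θ't : ℝ} (s₁ : ℝ) {t : ℝ} (hθ : HasDerivAt θ θ't t)
    (i j : κ) :
    HasDerivAt (fun τ : ℝ => (((θ τ : ℝ) : ℂ) •
        (NormedSpace.exp (-((s₁ - τ : ℝ) : ℂ) • H₁) * M * NormedSpace.exp (-(τ : ℂ) • H))) i j)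
      ((NormedSpace.exp (-((s₁ - t : ℝ) : ℂ) • H₁) *
          (((θ t : ℝ) : ℂ) • (H₁ * M - M * H) + ((θ't : ℝ) : ℂ) • M) *
        NormedSpace.exp (-(t : ℂ) • H)) i j) t := by
  have e1 : ∀ τ : ℝ, -((s₁ - τ : ℝ) : ℂ) • H₁ = (τ - s₁) • H₁ := fun τ => by
    rw [← Complex.ofReal_neg, neg_sub, rowDuhamel_coe_smul]
  have e2 : ∀ τ : ℝ, -(τ : ℂ) • H = τ • (-H) := fun τ => by
    rw [neg_smul, ← smul_neg, rowDuhamel_coe_smul]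
  simp only [e1, e2, rowDuhamel_coe_smul]
  open scoped Matrix.Norms.Operator in
  exact rowDuhamel_hasDerivAt_apply (rowDuhamel_hasDerivAt_weighted H₁ H M s₁ hθ) i j

set_option backward.isDefEq.respectTransparency false in
/-- **Continuity of the entrywise Duhamel integrand, in the statement's vocabulary.** If `θ, θ'`
are continuous on `S`, then for all `i, j` the scalar function
`τ ↦ (e^{-(s₁-τ)H₁} (θ(τ)(H₁M - MH) + θ'(τ)M) e^{-τH}) i j` is continuous on `S`. -/
theorem rowDuhamel_continuousOn_entry {κ : Type*} [Fintype κ] [DecidableEq κ]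
    (H₁ H M : Matrix κ κ ℂ) {θ θ' : ℝ → ℝ} (s₁ : ℝ) {S : Set ℝ}
    (hθ : ContinuousOn θ S) (hθ' : ContinuousOn θ' S) (i j : κ) :
    ContinuousOn (fun τ : ℝ => (NormedSpace.exp (-((s₁ - τ : ℝ) : ℂ) • H₁) *
          (((θ τ : ℝ) : ℂ) • (H₁ * M - M * H) + ((θ' τ : ℝ) : ℂ) • M) *
        NormedSpace.exp (-(τ : ℂ) • H)) i j) S := by
  have e1 : ∀ τ : ℝ, -((s₁ - τ : ℝ) : ℂ) • H₁ = (τ - s₁) • H₁ := fun τ => by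
    rw [← Complex.ofReal_neg, neg_sub, rowDuhamel_coe_smul]
  have e2 : ∀ τ : ℝ, -(τ : ℂ) • H = τ • (-H) := fun τ => by
    rw [neg_smul, ← smul_neg, rowDuhamel_coe_smul]
  simp only [e1, e2, rowDuhamel_coe_smul]
  open scoped Matrix.Norms.Operator in
  exact rowDuhamel_continuousOn_apply (rowDuhamel_continuousOn_integrand H₁ H M s₁ hθ hθ') i j

/-- **Cut-off Duhamel formula, entrywise** (registered stub `stub_rowDuhamel`). For a finite index
type `ι`, square complex matrices `H₁, H, M`, real functions `θ, θ'` with `θ` having derivative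
`θ'(τ)` at every `τ ∈ [s₀, s₁]` (`s₀ ≤ s₁`) and `θ'` continuous on `[s₀, s₁]`, and indices `i, j`:
`θ(s₁) (M e^{-s₁H}) i j - θ(s₀) (e^{-(s₁-s₀)H₁} M e^{-s₀H}) i j
  = ∫_{s₀}^{s₁} (e^{-(s₁-τ)H₁} (θ(τ)(H₁M - MH) + θ'(τ)M) e^{-τH}) i j dτ`.
Proof: the fundamental theorem of calculus (`intervalIntegral.integral_eq_sub_of_hasDerivAt`) for
`τ ↦ (θ(τ) e^{-(s₁-τ)H₁} M e^{-τH}) i j`, whose derivative (`rowDuhamel_hasDerivAt_entry`) is the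
integrand and is continuous on `[s₀, s₁]` (`rowDuhamel_continuousOn_entry`); at `τ = s₁` the first
exponential is `e^{0} = 1`. -/
theorem stub_rowDuhamel :
    ∀ (ι : Type) [Fintype ι] [DecidableEq ι] (H₁ H M : Matrix ι ι ℂ) (θ θ' : ℝ → ℝ) (s₀ s₁ : ℝ),
      s₀ ≤ s₁ → (∀ τ ∈ Set.Icc s₀ s₁, HasDerivAt θ (θ' τ) τ) → ContinuousOn θ' (Set.Icc s₀ s₁) →
      ∀ i j : ι,
        (θ s₁ : ℂ) * (M * NormedSpace.exp (-(s₁ : ℂ) • H)) i j -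
            (θ s₀ : ℂ) * (NormedSpace.exp (-((s₁ - s₀ : ℝ) : ℂ) • H₁) * M *
              NormedSpace.exp (-(s₀ : ℂ) • H)) i j =
          ∫ τ in s₀..s₁, (NormedSpace.exp (-((s₁ - τ : ℝ) : ℂ) • H₁) *
            (((θ τ : ℝ) : ℂ) • (H₁ * M - M * H) + ((θ' τ : ℝ) : ℂ) • M) *
              NormedSpace.exp (-(τ : ℂ) • H)) i j := by
  intro ι _ _ H₁ H M θ θ' s₀ s₁ hs hθ hθ' i j
  have hθc : ContinuousOn θ (Set.Icc s₀ s₁) := fun τ hτ =>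
    (hθ τ hτ).continuousAt.continuousWithinAt
  -- the derivative of `τ ↦ Φ(τ) i j` on `[s₀, s₁]` is the integrand
  have hderiv : ∀ τ ∈ Set.uIcc s₀ s₁, HasDerivAt (fun τ : ℝ => (((θ τ : ℝ) : ℂ) •
      (NormedSpace.exp (-((s₁ - τ : ℝ) : ℂ) • H₁) * M * NormedSpace.exp (-(τ : ℂ) • H))) i j)
      ((NormedSpace.exp (-((s₁ - τ : ℝ) : ℂ) • H₁) *
          (((θ τ : ℝ) : ℂ) • (H₁ * M - M * H) + ((θ' τ : ℝ) : ℂ) • M) *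
        NormedSpace.exp (-(τ : ℂ) • H)) i j) τ := by
    intro τ hτ
    rw [Set.uIcc_of_le hs] at hτ
    exact rowDuhamel_hasDerivAt_entry H₁ H M s₁ (hθ τ hτ) i j
  -- the integrand is continuous on `[s₀, s₁]`, hence interval integrable
  have hint : IntervalIntegrable (fun τ : ℝ => (NormedSpace.exp (-((s₁ - τ : ℝ) : ℂ) • H₁) *
          (((θ τ : ℝ) : ℂ) • (H₁ * M - M * H) + ((θ' τ : ℝ) : ℂ) • M) *
        NormedSpace.exp (-(τ : ℂ) • H)) i j) MeasureTheory.volume s₀ s₁ := by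
    refine ContinuousOn.intervalIntegrable ?_
    rw [Set.uIcc_of_le hs]
    exact rowDuhamel_continuousOn_entry H₁ H M s₁ hθc hθ' i j
  -- fundamental theorem of calculus, then evaluate the endpoints
  rw [intervalIntegral.integral_eq_sub_of_hasDerivAt hderiv hint]
  simp [Matrix.smul_apply, NormedSpace.exp_zero]

end Summit.QuantumFields.QCD.Cruxes.SmallFieldUltracontractivity.PointCentredAxialParabolic

end
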